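import Literature.MathematicalPhysics.QuantumFieldTheory.Balaban1983to89.Node00.N24Thm1Stage13RebindXWithB8PinB10Y0ZW0SepCoPHG
import Literature.MathematicalPhysics.QuantumFieldTheory.Balaban1983to89.Node00.Record13CarriersSepCoPHChi
import Literature.MathematicalPhysics.QuantumFieldTheory.Balaban1983to89.Node00.Record13SepCoPHChiCmap

/-!
# NODE N24 · THE χ-GENERIC EDITION OF THE `Y₀`-GENERIC FOUR-PIN STAGE-13 ENGINE GLUE: the record, the 𝐑-leaf reading and the ELEVEN nodes N01–N11 at a world bound to
# `(upOfRecord₅C (((((θ.rebindX X′).toStage5₁₃CoPHChi χ).pinB10).pinY Y₀).pinZ (Z11OfRecord ζ)).pinW W₀) P).withB8 (b8sel P)` — the β-slot small-field function a FIXED parameter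
# `(χ : ChiSlot F N)`, keyed on `[Ax-3d]`'s separated-range provisos `θ.Provisos₁₃SepCoPHChi F N χ` (WORK ORDER RC-1, director-ym №462 (B) ∕ №467 (D); K1ᴬ stmt-QuantumFields-27239)

TRACK A (YM-PLAN §2d, node N24 of 28 = binder B2, COMPOSITE), seat `pub-ymgap-dag-n24-c` g23 (op 5b ENGINE-LANE HAND, dag-lead HANDS I.21531 ∕ WORDS 581; `--kind proof --supports
stmt-QuantumFields-27239 --as helper`, count-neutral).  A NEW importing module: the four centre-reading theorems of this seat's `N24Thm1Stage13RebindXWithB8PinB10Y0ZW0SepCoPHG` (gen 14,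
INTENT-67; the K1 engine `…AtAbstractWitnessY0` §1 reads them BY NAME) RE-ISSUED χ-FIXED by the `[Ax-3b∕3c∕3d]` token map, so that the K1ᴬ engine can instantiate them at the RE-CENTRED
cut-off `χ := chiβOfRecord₁₃Ax F N θ.toStage13Params`:
* `N24_isRecordOfRecord₁₃CSepCoPHCmap_of_up_pinB10Y₀ZW₀_chi` · `N24_isRecordOfRecord₁₃CSepCoPHCmap_twin_of_up_withB8_rebindX_pinB10Y₀ZW₀_chi` — the world bound to the C-binding over the
  four-pin chain (resp. the C-bound TWIN of the `withB8` world over `θ.rebindX X′`) IS a record AT θ's χ-generic datum in node00-def-Y's centre-map class `IsRecordOfRecord₁₃CSepCoPHCmap`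
  (`Node00/Record13SepCoPHChiCmap`, ✓p807974) at the CONSTANT map `fun _ => χ` (= `[Ax-3d]`'s `IsRecordOfRecord₁₃CSepCoPHChi χ`, her `isRecordOfRecord₁₃CSepCoPHChi_iff_cmap_const`) —
  presenting parameter the pinned one; provisos by this seat's χ-carrier rows `Provisos₁₃SepCoPHChi.rebindX ∕ .pinB10 ∕ .pinY ∕ .pinZ ∕ .pinW` (`Record13CarriersSepCoPHChi`), admissibility
  `Iff.rfl` ×4, datum `rfl` ×4 UP-SIDE (`datumOfRecord₁₃SepCoPH_pin*_chi`), binding `toStage5₁₃CoPH_pin*_chi` (`Record13CarriersCoPHChi`).  RE-KEYED from the parent's CORE class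
  `IsRecordOfRecord₁₃CCoPH` (key `Provisos₁₃CoPH`) to the SEPARATED-RANGE layer: no χ edition of the CoPH-layer class exists and the engine holds the separated-range provisos anyway
  (`hP.toCore` in the parent's call) — so the nodes below read `hP : θ.Provisos₁₃SepCoPHChi F N χ`.
* `N24_rOperation_iff_of_up_withB8_rebindX_pinB10Y₀ZW₀_coPH_chi` — the 𝐑-leaf of the world IS `∀ k < K, TLaw₁₃CoPHChi θ χ P k → SLaw₁₃CoPHChi θ χ P (k+1)` (`[Ax-3c]` `rOpLeaf_VOfRecord₁₃CoPH_iff_chi`).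
* ★ `N24_nodes11_rOperation₁₃SepCoPHChi_rebindX_withB8_pinB10Y₀ZW₀_pointed_chi` — THE ELEVEN NODES N01–N11 AND THE 𝐑-OPERATION LEAF at the `withB8` world from the same displayed
  hypotheses as the parent (N05 ← `h05G`; N06 ← `h06 : B9LeafX Y₀`; N07 ∕ N08 leaves; N09 own leaf + Theorem-3 member `h09T`; N10 socket; N11 (S1ᵀ) `h11` and the 𝐑-reading `hR`, both
  now over `SLaw₁₃CoPHChi ∕ TLaw₁₃CoPHChi θ χ`).  Proof = the parent's bytes with: N01 ∕ N02 ∕ N03 ∕ N04 through node00-def-Y's door `atWorld_of_isRecordOfRecord₁₃CSepCoPHCmap` at the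
  twin record (NODE 00's `b4 ∕ b5 ∕ b7_main_of_isRecordOfRecord₅C`, dag-n03-a's `N03_at_record₅C`); N14's knit `b14_main_at_construction_rhoOfRecord9_along` at the χ-generic core
  `coreOfRecord₁₃CoPHChi θ χ` (objects `EOfRecord₁₃Chi`, `gOfRecord₁₃Chi`, laws `SLaw₁₃CoPHChi ∕ TLaw₁₃CoPHChi`, faces `datumOfRecord₁₃SepCoPH_C_chi`, `sLaw₁₃CoPH_zero_chi`); the Stage-5
  pin leaves (`upOfRecord₅C_pinW_b9_b10_b11`, `…_pinY_b9_iff`, `…_pinB10_b10_iff`, `…_pinZ_b11_iff`, `…_pinW_rBasicStep_iff`), N05's `B8LeafKnit.b8_main_of_leaf`, N09's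
  `B12NodeKnitRecord8.b12_main_of_leaf_of_thm3Member`, N10's `B13NodeKnitRecord5C.b13_main_at_stage5ParamsC` are CENTRE-FREE and cited verbatim.
The parent's §0 `thm1Printed_of_nodes11_of_rOperation` (world-generic) and §1 G-class hosting are NOT re-issued: the consumer reads the former BY NAME and needs no G-class at χ
(its two uses — `w.C = D.C` and the guarded (0.20) door — are `hC` itself and this seat's class-free `rgFlow_of_smallCouplings_of_C_eq_datumOfRecord₁₃SepCoPHChi`, ✓p808852 §0).

HONEST FRAMING: kernel bookkeeping by name (σ re-issue of landed glue; `rfl`, `Iff.rfl`, structure updates, citations of landed leaves); every node's printed content stays a DISPLAYED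
hypothesis (`h05G … h11`, `hR`); nothing of Bałaban asserted; no node discharged; N24 COMPOSITE — count-neutral; K1ᴬ DECIDING ∕ OPEN, not claimed; counts unmoved (discharged 8∕27 ·
K 1∕4); one finite 𝕋⁴ programme at fixed ε = L^{−K} — NOT continuum ∕ ℝ⁴ ∕ OS ∕ mass gap ∕ Clay.  Theorems only: no `def`, no `instance`, no `notation`, no `sorry`; standard axioms.
References (context; bookkeeping over the cell's DAG): [V] = [Balaban1989LargeFieldII] Thm 1 p.355, (0.1) pp.355–356, p.387, p.391; [III] = [Balaban1988Convergent] (2.18) p.257,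
Thm 1 p.262, Thm 2 p.263, p.244; [I] = [Balaban1987RG1] (2.9) p.266, Thm 3 p.264; [Balaban1985RegularSpaces] Lemma 1 – Thm 8 pp.79–101; [Balaban1985BackgroundPropagators]
Thm 3.1 p.397; [Balaban1985Variational] Thm 1 p.279; [Balaban1985UV3] Thm 1 p.257, Thm 2 p.258; [Balaban1988RG2Cluster] Lemmas 1–3 pp.9–20; [Balaban1989LargeFieldI] (0.2) p.176.
-/

noncomputable section

open scoped Matrix.Norms.L2Operator

namespace Literature.MathematicalPhysics.QuantumFieldTheory.Balaban1983to89.Node00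

open DagBinding T4Continuum T4DatumAssembly FlowStepRuns AveragingRT
open FlowStep (BetaLowerH BetaUpperH)
open B14NodeKnitRecord9 (b14_main_at_construction_rhoOfRecord9_along)

variable {F : T4Family} {N : ℕ} [NeZero N]

/-! ## §0χ. The record of the four-pin chain and of the C-bound twin, the 𝐑-leaf reading — χ-fixed -/

/-- **THE WORLD BOUND TO THE C-BINDING OVER THE FOUR-PIN χ-GENERIC STAGE-13 VIEW `((((θ.toStage5₁₃CoPHChi χ).pinB10).pinY Y₀).pinZ (Z11OfRecord ζ)).pinW W₀` IS A RECORD AT θ's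
χ-GENERIC DATUM** in node00-def-Y's centre-map class at the constant map `fun _ => χ` (presenting parameter `(((θ.pinB10).pinY Y₀).pinZ (Z11OfRecord ζ)).pinW W₀`; provisos
`Provisos₁₃SepCoPHChi.pinB10 ∕ .pinY ∕ .pinZ ∕ .pinW`, admissibility `Iff.rfl` ×4, datum `rfl` ×4 up-side, binding `toStage5₁₃CoPH_pin*_chi`).  The χ-fixed, separated-range-keyed twin of the
parent's `N24_isRecordOfRecord₁₃CCoPH_of_up_pinB10Y₀ZW₀`. [cite: Balaban1989LargeFieldII, Thm 1 + (0.1) pp.355–356; Balaban1988Convergent, (2.18) p.257; Balaban1985UV3, Thm 1 p.257; Balaban1985BackgroundPropagators, Thm 3.1 p.397; Balaban1985Variational, Thm 1 p.279; Balaban1989LargeFieldI, (0.2) p.176; Balaban1987RG1, (2.9) p.266 (objects of record; bookkeeping)] -/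
theorem N24_isRecordOfRecord₁₃CSepCoPHCmap_of_up_pinB10Y₀ZW₀_chi (θ : Stage13HParams F N) (χ : ChiSlot F N) (hP : θ.Provisos₁₃SepCoPHChi F N χ) (hθ : θ.Admissible F N)
    (Y₀ : PrintedCarriers9X) (ζ : ResidZ F N) (W₀ : B12.RunParams → PrintedCarriers15) (w : WorldP)
    (hC : w.C = (datumOfRecord₁₃SepCoPHChi F N θ χ hP).C) (hγ : 0 < w.γ ∧ w.γ ≤ θ.γ) (hL : w.L = (θ.L : ℝ))
    (hup : ∀ P, w.up P = upOfRecord₅C F N (((((θ.toStage5₁₃CoPHChi F N χ).pinB10 F N).pinY F N (Y₀)).pinZ F N (Z11OfRecord F N ζ)).pinW F N W₀) P) :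
    IsRecordOfRecord₁₃CSepCoPHCmap F N (fun _ => χ) (datumOfRecord₁₃SepCoPHChi F N θ χ hP) w := by
  refine ⟨(((θ.pinB10 F N).pinY F N (Y₀)).pinZ F N (Z11OfRecord F N ζ)).pinW F N W₀,
    ((hP.pinB10.pinY (Y₀)).pinZ (Z11OfRecord F N ζ)).pinW W₀,
    (Stage13Params.pinW_admissible_iff F N _ _).2 ((Stage13Params.pinZ_admissible_iff F N _ _).2
      ((Stage13Params.pinY_admissible_iff F N _ _).2 ((Stage13Params.pinB10_admissible_iff F N θ.toStage13Params).2 hθ))), ?_, hC, hγ, hL, fun P => ?_⟩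
  · exact ((datumOfRecord₁₃SepCoPH_pinB10_chi F N θ χ hP).symm.trans
      ((datumOfRecord₁₃SepCoPH_pinY_chi F N (θ.pinB10 F N) χ hP.pinB10 (Y₀)).symm.trans
        ((datumOfRecord₁₃SepCoPH_pinZ_chi F N _ χ (hP.pinB10.pinY (Y₀)) (Z11OfRecord F N ζ)).symm.trans
          (datumOfRecord₁₃SepCoPH_pinW_chi F N _ χ ((hP.pinB10.pinY (Y₀)).pinZ (Z11OfRecord F N ζ))
            W₀).symm)))
  · rw [hup P, Stage13HParams.toStage5₁₃CoPH_pinW_chi, Stage13HParams.toStage5₁₃CoPH_pinZ_chi, Stage13HParams.toStage5₁₃CoPH_pinY_chi, Stage13HParams.toStage5₁₃CoPH_pinB10_chi]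

/-- **THE C-BOUND TWIN WORLD OF THE GENERIC CHAIN OVER `θ.rebindX X′` (free [B9] bundle `Y₀`) IS A RECORD AT θ's χ-GENERIC DATUM** (datum read back by this seat's χ-carrier row
`datumOfRecord₁₃SepCoPH_rebindX_chi`; the χ-fixed twin of the parent's `N24_isRecordOfRecord₁₃CCoPH_twin_of_up_withB8_rebindX_pinB10Y₀ZW₀`).
[cite: Balaban1989LargeFieldII, Thm 1 + (0.1) pp.355–356; Balaban1988Convergent, (2.18) p.257, p.244; Balaban1987RG1, (2.9) p.266 (bookkeeping)] -/
theorem N24_isRecordOfRecord₁₃CSepCoPHCmap_twin_of_up_withB8_rebindX_pinB10Y₀ZW₀_chi (θ : Stage13HParams F N) (χ : ChiSlot F N) (hP : θ.Provisos₁₃SepCoPHChi F N χ) (hθ : θ.Admissible F N)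
    (X' : B12.RunParams → PrintedCarriersR) (Y₀ : PrintedCarriers9X) (ζ : ResidZ F N) (W₀ : B12.RunParams → PrintedCarriers15) (w : WorldP)
    (hC : w.C = (datumOfRecord₁₃SepCoPHChi F N θ χ hP).C) (hγ : 0 < w.γ ∧ w.γ ≤ θ.γ) (hL : w.L = (θ.L : ℝ)) :
    IsRecordOfRecord₁₃CSepCoPHCmap F N (fun _ => χ) (datumOfRecord₁₃SepCoPHChi F N θ χ hP)
      { w with up := fun P => upOfRecord₅C F N ((((((θ.rebindX F N X').toStage5₁₃CoPHChi F N χ).pinB10 F N).pinY F N (Y₀)).pinZ F N (Z11OfRecord F N ζ)).pinW F N W₀) P } := by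
  have hX : (θ.rebindX F N X').Provisos₁₃SepCoPHChi F N χ := hP.rebindX X'
  have hD : datumOfRecord₁₃SepCoPHChi F N (θ.rebindX F N X') χ hX = datumOfRecord₁₃SepCoPHChi F N θ χ hP := datumOfRecord₁₃SepCoPH_rebindX_chi F N θ χ hP X' hX
  rw [← hD]
  exact N24_isRecordOfRecord₁₃CSepCoPHCmap_of_up_pinB10Y₀ZW₀_chi (θ.rebindX F N X') χ hX ((Stage13HParams.rebindX_admissible_iff F N θ X').2 hθ)
    Y₀ ζ W₀ _ (hC.trans (congrArg FiniteEpsData.C hD.symm)) hγ hL (fun _ => rfl)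

/-- **The pins (any [B9] bundle `Y₀`) and a `withB8` re-binding never touch the 𝐑-carrier**, χ-generic: `(leavesP w P).rOperation ↔ ∀ k < K, TLaw₁₃CoPHChi θ χ P k → SLaw₁₃CoPHChi θ χ P (k+1)`
(`Iff.rfl` to `ROpLeaf (VOfRecord₁₃CoPHChi (θ.rebindX X′) χ P)`, then `[Ax-3c]`'s `rOpLeaf_VOfRecord₁₃CoPH_iff_chi`; the re-binding does not touch the laws).
[cite: Balaban1988Convergent, Thm 2 p.263, (2.18) p.257; Balaban1989LargeFieldI, (0.2)–(0.4) p.176 (bookkeeping)] -/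
theorem N24_rOperation_iff_of_up_withB8_rebindX_pinB10Y₀ZW₀_coPH_chi (θ : Stage13HParams F N) (χ : ChiSlot F N) (X' : B12.RunParams → PrintedCarriersR) (Y₀ : PrintedCarriers9X)
    (ζ : ResidZ F N) (W₀ : B12.RunParams → PrintedCarriers15) {b : Prop} {w : WorldP} {P : B12.RunParams}
    (hup : w.up P = (upOfRecord₅C F N ((((((θ.rebindX F N X').toStage5₁₃CoPHChi F N χ).pinB10 F N).pinY F N (Y₀)).pinZ F N (Z11OfRecord F N ζ)).pinW F N W₀) P).withB8 b) :
    (leavesP w P).rOperation ↔ ∀ k, k < P.K → TLaw₁₃CoPHChi F N θ χ P k → SLaw₁₃CoPHChi F N θ χ P (k + 1) := by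
  have hV : (leavesP w P).rOperation ↔ ROpLeaf (VOfRecord₁₃CoPHChi F N (θ.rebindX F N X') χ P) := by
    show (w.up P).rOperation ↔ _
    rw [hup]
    exact Iff.rfl
  exact hV.trans (rOpLeaf_VOfRecord₁₃CoPH_iff_chi F N (θ.rebindX F N X') χ P)

/-! ## §1. The G-class hosting and the ELEVEN nodes N01–N11 + the 𝐑-operation leaf at such a world (N06 ← `h06 : B9LeafX Y₀`) -/

/-! ## §1χ. ★ The ELEVEN nodes N01–N11 and the 𝐑-operation leaf at the `withB8` world over the χ-generic four-pin chain -/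

/-- **★ N24 · THE ELEVEN NODES N01–N11 AND THE 𝐑-OPERATION LEAF AT A WORLD BOUND TO THE χ-GENERIC FOUR-PIN CHAIN WITH A FREE [B9] BUNDLE `Y₀`** (`X′`, `Y₀`, `W₀`, `b8sel` FREE;
`W₀` UNREAD; key `hP : θ.Provisos₁₃SepCoPHChi F N χ`): N05 ← `h05G`; N06 ← `h06 : B9LeafX Y₀`; N07 ∕ N08 leaves; N09 own leaf + Theorem-3 member `h09T`; N10 socket (antecedent `B9LeafX Y₀`);
N11 (S1ᵀ) `h11` over `SLaw₁₃CoPHChi ∕ TLaw₁₃CoPHChi θ χ`; the 𝐑-reading `hR` ⇒ the eleven nodes `Dag.B4_main … Dag.B14_main` and `(leavesP w P).rOperation` at every run.  The χ-fixed twin of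
the parent's `N24_nodes11_rOperation₁₃CoPH_rebindX_withB8_pinB10Y₀ZW₀_pointed` (its proof bytes; N01–N04 through node00-def-Y's `atWorld_of_isRecordOfRecord₁₃CSepCoPHCmap` at §0χ's twin record,
N14 at the χ-generic core `coreOfRecord₁₃CoPHChi θ χ`).  CONDITIONAL on every displayed hypothesis; nothing of Bałaban asserted.
[cite: Balaban1989LargeFieldII, Thm 1 p.355, (0.1) pp.355–356, p.387, p.391; Balaban1985RegularSpaces, Lemma 1 – Thm 8 pp.79–101, Thm 8 (1.146) p.101; Balaban1985BackgroundPropagators, Thms 3.1–3.15 pp.397–432; Balaban1985Variational, Thm 1 p.279, Props 2–9 pp.281–309; Balaban1985UV3, Thm 1 p.257, Thm 2 p.272; Balaban1987RG1, Lemma 4 p.280, Thm 3 p.264, (2.9) p.266; Balaban1988RG2Cluster, Lemmas 1–3 pp.9–20; Balaban1988Convergent, Thm 1 p.262, Thm 2 p.263, p.244 (bookkeeping over the cell's DAG)] -/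
theorem N24_nodes11_rOperation₁₃SepCoPHChi_rebindX_withB8_pinB10Y₀ZW₀_pointed_chi (θ : Stage13HParams F N) (χ : ChiSlot F N) (hP : θ.Provisos₁₃SepCoPHChi F N χ) (hθ : θ.Admissible F N)
    (X' : B12.RunParams → PrintedCarriersR) (Y₀ : PrintedCarriers9X) (ζ : ResidZ F N)
    (W₀ : B12.RunParams → PrintedCarriers15) (b8sel : B12.RunParams → Prop) (w : WorldP)
    (hC : w.C = (datumOfRecord₁₃SepCoPHChi F N θ χ hP).C) (hγ : 0 < w.γ ∧ w.γ ≤ θ.γ) (hL : w.L = (θ.L : ℝ))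
    (hup : ∀ P, w.up P = (upOfRecord₅C F N ((((((θ.rebindX F N X').toStage5₁₃CoPHChi F N χ).pinB10 F N).pinY F N (Y₀)).pinZ F N (Z11OfRecord F N ζ)).pinW F N W₀) P).withB8 (b8sel P))
    (h05G : ∀ P : B12.RunParams, b8sel P)
    (h06 : B9LeafX (Y₀))
    (h07 : B11Leaf (Z11OfRecord F N ζ))
    (h08 : PrintedUV3V N θ.L)
    (h09 : ∀ P : B12.RunParams, B12Sec2to5.Lemma4Printed (X' P).F12 (X' P).c12)
    (h09T : ∀ P : B12.RunParams, (leavesP w P).smallCouplings → (leavesP w P).smallFieldInductive)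
    (h10 : ∀ P : B12.RunParams, B9LeafX (Y₀) →
      (B10.Thm1PrintedCompact (((((((θ.rebindX F N X').toStage5₁₃CoPHChi F N χ).pinB10 F N).pinY F N (Y₀)).pinZ F N (Z11OfRecord F N ζ)).pinW F N W₀).res.X P).runs10 ∧
          B10.Thm2Printed (((((((θ.rebindX F N X').toStage5₁₃CoPHChi F N χ).pinB10 F N).pinY F N (Y₀)).pinZ F N (Z11OfRecord F N ζ)).pinW F N W₀).res.X P).runs10) →
        B11Leaf (Z11OfRecord F N ζ) → B12Sec2to5.Lemma4Printed (X' P).F12 (X' P).c12 →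
          B13.Lemma1Printed (X' P).S13 (X' P).c13 ∧ B13.Lemma2Printed (X' P).S13 (X' P).c13 ∧
            B13.Lemma3Printed (X' P).S13 (X' P).c13)
    (h11 : ∀ P : B12.RunParams, (leavesP w P).b7 → (leavesP w P).b8 → (leavesP w P).b9 → (leavesP w P).b10 → (leavesP w P).b11 →
      (leavesP w P).smallCouplings → (leavesP w P).smallFieldInductive → (leavesP w P).flowControl →
        ∀ k, k < P.K → SLaw₁₃CoPHChi F N θ χ P k → TLaw₁₃CoPHChi F N θ χ P k)
    (hR : ∀ (P : B12.RunParams) (k : ℕ), k < P.K → TLaw₁₃CoPHChi F N θ χ P k → SLaw₁₃CoPHChi F N θ χ P (k + 1)) :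
    ∀ P : B12.RunParams, (Dag.B4_main (leavesP w P) ∧ Dag.B5_main (leavesP w P) ∧ Dag.B6_main (leavesP w P) ∧ Dag.B7_main (leavesP w P) ∧
      Dag.B8_main (leavesP w P) ∧ Dag.B9_main (leavesP w P) ∧ Dag.B10_main (leavesP w P) ∧ Dag.B11_main (leavesP w P) ∧
      Dag.B12_main (leavesP w P) ∧ Dag.B13_main (leavesP w P) ∧ Dag.B14_main (leavesP w P)) ∧ (leavesP w P).rOperation := by
  intro P
  have hrec' := N24_isRecordOfRecord₁₃CSepCoPHCmap_twin_of_up_withB8_rebindX_pinB10Y₀ZW₀_chi θ χ hP hθ X' Y₀ ζ W₀ w hC hγ hL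
  have hleaves := leavesP_eq_of_up_withB8 hup P
  have h4 : Dag.B4_main (leavesP w P) := by rw [hleaves]; exact atWorld_of_isRecordOfRecord₁₃CSepCoPHCmap (fun _ _ h5 P => b4_main_of_isRecordOfRecord₅C h5 P) hrec' P
  have h5 : Dag.B5_main (leavesP w P) := by rw [hleaves]; exact atWorld_of_isRecordOfRecord₁₃CSepCoPHCmap (fun _ _ h5 P => b5_main_of_isRecordOfRecord₅C h5 P) hrec' P
  have h6 : Dag.B6_main (leavesP w P) := by rw [hleaves]; exact atWorld_of_isRecordOfRecord₁₃CSepCoPHCmap (fun _ _ h5 P => N03_at_record₅C h5 P) hrec' P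
  have h7 : Dag.B7_main (leavesP w P) := by rw [hleaves]; exact atWorld_of_isRecordOfRecord₁₃CSepCoPHCmap (fun _ _ h5 P => b7_main_of_isRecordOfRecord₅C h5 P) hrec' P
  have hw := upOfRecord₅C_pinW_b9_b10_b11 F N (((((θ.rebindX F N X').toStage5₁₃CoPHChi F N χ).pinB10 F N).pinY F N (Y₀)).pinZ F N (Z11OfRecord F N ζ)) W₀ P
  have hl : ((upOfRecord₅C F N ((((((θ.rebindX F N X').toStage5₁₃CoPHChi F N χ).pinB10 F N).pinY F N (Y₀)).pinZ F N (Z11OfRecord F N ζ)).pinW F N W₀) P).rBasicStep ↔ B15Leaf (W₀ P)) ∧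
      ((upOfRecord₅C F N ((((((θ.rebindX F N X').toStage5₁₃CoPHChi F N χ).pinB10 F N).pinY F N (Y₀)).pinZ F N (Z11OfRecord F N ζ)).pinW F N W₀) P).b9 ↔ B9LeafX (Y₀)) ∧
      ((upOfRecord₅C F N ((((((θ.rebindX F N X').toStage5₁₃CoPHChi F N χ).pinB10 F N).pinY F N (Y₀)).pinZ F N (Z11OfRecord F N ζ)).pinW F N W₀) P).b10 ↔ PrintedUV3V N θ.L) ∧
      ((upOfRecord₅C F N ((((((θ.rebindX F N X').toStage5₁₃CoPHChi F N χ).pinB10 F N).pinY F N (Y₀)).pinZ F N (Z11OfRecord F N ζ)).pinW F N W₀) P).b11 ↔ B11Leaf (Z11OfRecord F N ζ)) := by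
    refine ⟨upOfRecord₅C_pinW_rBasicStep_iff F N _ _ P, ?_, ?_, ?_⟩
    · rw [hw.1, upOfRecord₅C_pinZ_b9]
      exact upOfRecord₅C_pinY_b9_iff F N _ _ P
    · rw [hw.2.1, upOfRecord₅C_pinZ_b10, upOfRecord₅C_pinY_b10]
      exact upOfRecord₅C_pinB10_b10_iff F N ((θ.rebindX F N X').toStage5₁₃CoPHChi F N χ) P
    · rw [hw.2.2]
      exact upOfRecord₅C_pinZ_b11_iff F N _ _ P
  have h8 : (w.up P).b8 := by rw [hup P]; exact h05G P
  have h9 : (w.up P).b9 := by rw [hup P]; exact hl.2.1.2 h06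
  have h10leaf : (w.up P).b10 := by rw [hup P]; exact hl.2.2.1.2 h08
  have h11leaf : (w.up P).b11 := by rw [hup P]; exact hl.2.2.2.2 h07
  have h12leaf : (leavesP w P).b12 := by
    show (w.up P).b12
    rw [hup P]; exact h09 P
  have h13 : Dag.B13_main (leavesP w P) := by
    have h' : Dag.B13_main (leavesP { w with up := fun P => upOfRecord₅C F N ((((((θ.rebindX F N X').toStage5₁₃CoPHChi F N χ).pinB10 F N).pinY F N (Y₀)).pinZ F N (Z11OfRecord F N ζ)).pinW F N W₀) P } P) :=
      B13NodeKnitRecord5C.b13_main_at_stage5ParamsC F N ((((((θ.rebindX F N X').toStage5₁₃CoPHChi F N χ).pinB10 F N).pinY F N (Y₀)).pinZ F N (Z11OfRecord F N ζ)).pinW F N W₀) _ P rfl (h10 P)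
    show (w.up P).b9 → (w.up P).b10 → (w.up P).b11 → (w.up P).b12 → (w.up P).b13
    rw [hup P]
    exact h'
  have hrop := N24_rOperation_iff_of_up_withB8_rebindX_pinB10Y₀ZW₀_coPH_chi θ χ X' Y₀ ζ W₀ (hup P)
  exact ⟨⟨h4, h5, h6, h7, B8LeafKnit.b8_main_of_leaf w P h8, fun _ _ _ _ => h9, fun _ _ _ _ _ _ => h10leaf,
    fun _ _ _ _ _ => h11leaf, B12NodeKnitRecord8.b12_main_of_leaf_of_thm3Member h12leaf (h09T P), h13,
    b14_main_at_construction_rhoOfRecord9_along F N (coreOfRecord₁₃CoPHChi F N θ χ) w P θ.ν θ.τ9 (EOfRecord₁₃Chi F N θ.toStage13Params χ) (wOfRecord₉ F N θ.toStage9Params) θ.ppSel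
      (gOfRecord₁₃Chi F N θ.toStage13Params χ) (fun p k _ => SLaw₁₃CoPHChi F N θ χ p k) (fun p k _ => TLaw₁₃CoPHChi F N θ χ p k) (hC.trans (datumOfRecord₁₃SepCoPH_C_chi F N θ χ hP))
      (fun _ _ => Iff.rfl) (fun _ => sLaw₁₃CoPH_zero_chi F N θ χ P) (h11 P) (fun hr => hrop.1 hr)⟩, hrop.2 (hR P)⟩

end Literature.MathematicalPhysics.QuantumFieldTheory.Balaban1983to89.Node00

end
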